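import Mathlib
import Literature.NumberTheory.LFunctions.Zhang2022.AppendixBVarrho
import Literature.NumberTheory.LFunctions.Zhang2022.SkeletonPartThree
import HarnessLib

/-!
# Zhang (2022), Appendix B, (B.2): `Σ_{n<P, (n,𝔮)>1} |ϱ_j(n)|/n ≪ 𝓛⁻⁸` in the source's setting

Topic `Literature/NumberTheory/LFunctions/Zhang2022` (Landau–Siegel audit tree; verdict-neutral).
Y. Zhang, *Discrete mean estimates and the Landau–Siegel zero*, arXiv:2211.02515v1 (2022)
[Zhang2022LandauSiegel] — **an unrefereed manuscript under adjudication**. This file specialises the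
abstract estimate `AppendixBVarrho.sum_norm_rho_div_not_coprime_le` to the parameters of the source
(`𝓛 = log D`, `P = e^{𝓛⁹}`, `α = π/log P` (2.10), `β_j ∈ {β₁, β₂, β₃}` purely imaginary with
`|β_j| ≤ 3α(1 + 5|c′|α𝓛)` (2.13), `𝔮 = ∏_{q<D⁴} q` (§15 p. 31); skeleton objects `Skeleton.ell`,
`bigP`, `alpha`, `betaJ`, `frakq`) and PROVES display **(B.2)** of Appendix B (p. 107, tex L5271),
"`Σ_{n<P, (n,𝔮)>1} |ϱ_j(n)|/n ≪ 𝓛⁻⁸`", UNCONDITIONALLY, for every `j` and every range `n ≤ X ≤ ⌊P²⌋`: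
`appB2_rho` (uniform in the real shift `v`, `|v| ≤ 3α(1+5|c′|α𝓛)`) and `appB2_bound` (the display as
printed, `ϱ_j(n) = Σ_{d∣n} μ(d)d^{β_j}` spelled out, in the skeleton's `ForAllLarge` frame). Constants:
`|β_j| log 4X ≤ 12π(1+5|c′|π)` and `|β_j|·Σ_{q<D⁴} log q/q ≤ 18π(1+5|c′|π)𝓛⁻⁸` for `D ≥ 3`.
DAG node (cell siegel-zhang): `Z22:(B.2)`. What is NOT here: (B.1) (separate file), the rest of the
proof of Lemma 15.1, any claim about Theorems 1–2 of the source.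
-/

noncomputable section

open Complex Real Finset ArithmeticFunction

namespace Literature.NumberTheory.LFunctions.Zhang2022.AppendixBVarrho

open Literature.NumberTheory.LFunctions.Zhang2022 Skeleton MeanSquareMajorant

/-! ## The setting of the source: `β_j = iv_j`, `|v_j| ≤ 3α(1 + 5|c′|α𝓛)`, `α = π/𝓛⁹`, `𝔮 = ∏_{q<D⁴} q` -/

/-- `β_j` is purely imaginary, `β_j = iv` with `|v| ≤ 3α(1 + 5|c′|α𝓛)` (`β₁ = iα(1−5c′α𝓛)`,
`β₂ = 2iα(1+c′α𝓛)`, `β₃ = 3iα(1−c′α𝓛)`, (2.13); `j` read mod `3`). [cite: Zhang2022LandauSiegel, §2 (2.13)] -/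
theorem betaJ_eq_ofReal_mul_I (c' : ℝ) (D : ℕ) (j : ℕ) :
    ∃ v : ℝ, betaJ c' D j = (v : ℂ) * I ∧ |v| ≤ 3 * alpha D * (1 + 5 * |c'| * alpha D * ell D) := by
  have hℓ : 0 ≤ ell D := Real.log_natCast_nonneg D
  have hα : 0 ≤ alpha D := by
    unfold alpha bigP
    rw [Real.log_exp]
    positivity
  have hαℓ : 0 ≤ alpha D * ell D := mul_nonneg hα hℓ
  have hc : |c' * alpha D * ell D| = |c'| * alpha D * ell D := by
    rw [abs_mul, abs_mul, abs_of_nonneg hα, abs_of_nonneg hℓ]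
  unfold betaJ
  split_ifs
  · refine ⟨alpha D * (1 - 5 * c' * alpha D * ell D), by unfold beta1; push_cast; ring, ?_⟩
    rw [abs_mul, abs_of_nonneg hα]
    have h1 : |1 - 5 * c' * alpha D * ell D| ≤ 1 + 5 * |c'| * alpha D * ell D := by
      calc |1 - 5 * c' * alpha D * ell D| ≤ |(1 : ℝ)| + |5 * c' * alpha D * ell D| := abs_sub _ _
        _ = 1 + 5 * |c'| * alpha D * ell D := by
            rw [abs_one, show 5 * c' * alpha D * ell D = 5 * (c' * alpha D * ell D) by ring,
              abs_mul, hc]; norm_num; ring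
    nlinarith [mul_nonneg (abs_nonneg c') hαℓ, abs_nonneg (1 - 5 * c' * alpha D * ell D)]
  · refine ⟨2 * alpha D * (1 + c' * alpha D * ell D), by unfold beta2; push_cast; ring, ?_⟩
    rw [abs_mul, abs_mul, abs_of_nonneg hα, abs_two]
    have h1 : |1 + c' * alpha D * ell D| ≤ 1 + |c'| * alpha D * ell D := by
      calc |1 + c' * alpha D * ell D| ≤ |(1 : ℝ)| + |c' * alpha D * ell D| := abs_add_le _ _
        _ = 1 + |c'| * alpha D * ell D := by rw [abs_one, hc]
    nlinarith [mul_nonneg (abs_nonneg c') hαℓ, abs_nonneg (1 + c' * alpha D * ell D)]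
  · refine ⟨3 * alpha D * (1 - c' * alpha D * ell D), by unfold beta3; push_cast; ring, ?_⟩
    rw [abs_mul, abs_mul, abs_of_nonneg hα, show |(3 : ℝ)| = 3 by norm_num]
    have h1 : |1 - c' * alpha D * ell D| ≤ 1 + |c'| * alpha D * ell D := by
      calc |1 - c' * alpha D * ell D| ≤ |(1 : ℝ)| + |c' * alpha D * ell D| := abs_sub _ _
        _ = 1 + |c'| * alpha D * ell D := by rw [abs_one, hc]
    nlinarith [mul_nonneg (abs_nonneg c') hαℓ, abs_nonneg (1 - c' * alpha D * ell D)]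

/-- With `β_j = iv`, the source's `ϱ_j(n) = Σ_{d∣n} μ(d)d^{β_j}` is `rho v n`.
[cite: Zhang2022LandauSiegel, Appendix B (proof of Lemma 15.1)] -/
theorem rho_eq_sum_of_betaJ {c' : ℝ} {D : ℕ} {j : ℕ} {v : ℝ} (hv : betaJ c' D j = (v : ℂ) * I)
    (n : ℕ) :
    ∑ d ∈ n.divisors, (ArithmeticFunction.moebius d : ℂ) * (d : ℂ) ^ betaJ c' D j = rho v n := by
  rw [hv]; rfl

/-- `𝔮 = ∏_{q<D⁴} q` unfolded. [folklore] -/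
private theorem frakq_eq_prod (D : ℕ) : frakq D = ∏ q ∈ (Finset.range (D ^ 4)).filter Nat.Prime, q := rfl

/-- The elementary facts about the parameters for `D ≥ 3`: `1 ≤ 𝓛`, `α = π/𝓛⁹`, `α𝓛 ≤ π`, `0 ≤ α`.
[cite: Zhang2022LandauSiegel, §2 (2.1), (2.6), (2.10)] -/
theorem params_of_three_le {D : ℕ} (hD : 3 ≤ D) :
    1 ≤ ell D ∧ alpha D = Real.pi / ell D ^ 9 ∧ alpha D * ell D ≤ Real.pi ∧ 0 ≤ alpha D := by
  have hℓ : 1 ≤ ell D := by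
    have h3 : (3 : ℝ) ≤ D := by exact_mod_cast hD
    exact le_trans MertensBound.one_lt_log_three.le (Real.log_le_log (by norm_num) h3)
  have hα : alpha D = Real.pi / ell D ^ 9 := by unfold alpha bigP; rw [Real.log_exp]
  have hℓ9 : 1 ≤ ell D ^ 9 := one_le_pow₀ hℓ
  refine ⟨hℓ, hα, ?_, by rw [hα]; positivity⟩
  rw [hα, div_mul_eq_mul_div, div_le_iff₀ (by positivity)]
  have : ell D ≤ ell D ^ 9 := by
    calc ell D = ell D ^ 1 := (pow_one _).symm
      _ ≤ ell D ^ 9 := pow_le_pow_right₀ hℓ (by norm_num)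
  nlinarith [Real.pi_pos]

/-- `Σ_{q<D⁴} log q/q ≤ 6𝓛` for `D ≥ 3` (Mertens: `≤ log D⁴ + log 4`; the source's evaluation of
"`α Σ_{q<D⁴} log q/q`" as `≪ α𝓛 ≪ 𝓛⁻⁸`). [cite: Zhang2022LandauSiegel, Appendix B (proof of (B.2))] -/
theorem sum_log_div_prime_window_le {D : ℕ} (hD : 3 ≤ D) :
    ∑ q ∈ (Finset.range (D ^ 4)).filter Nat.Prime, Real.log q / q ≤ 6 * ell D := by
  obtain ⟨hℓ, -, -, -⟩ := params_of_three_le hD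
  have hsub : (Finset.range (D ^ 4)).filter Nat.Prime ⊆ Nat.primesLE (D ^ 4) := by
    intro q hq
    rw [mem_filter, Finset.mem_range] at hq
    exact Nat.mem_primesLE.mpr ⟨hq.1.le, hq.2⟩
  have hD0 : (0 : ℝ) < D := by exact_mod_cast (show 0 < D by omega)
  calc ∑ q ∈ (Finset.range (D ^ 4)).filter Nat.Prime, Real.log q / q
      ≤ ∑ q ∈ Nat.primesLE (D ^ 4), Real.log q / q :=
        sum_le_sum_of_subset_of_nonneg hsub fun q hq _ =>
          div_nonneg (Real.log_nonneg (by exact_mod_cast (Nat.mem_primesLE.mp hq).2.one_lt.le))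
            (Nat.cast_nonneg _)
    _ ≤ Real.log ((D ^ 4 : ℕ) : ℝ) + Real.log 4 := MertensBound.sum_log_div_prime_le _
    _ = 4 * ell D + Real.log 4 := by rw [Nat.cast_pow, Real.log_pow]; rfl
    _ ≤ 6 * ell D := by
        have h4 : Real.log 4 ≤ 2 := by
          have := Real.log_le_sub_one_of_pos (show (0 : ℝ) < 4 by norm_num)
          have h2 : Real.log 4 = 2 * Real.log 2 := by
            rw [show (4 : ℝ) = 2 ^ 2 by norm_num, Real.log_pow]; norm_num
          rw [h2]; linarith [Real.log_two_lt_d9]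
        linarith

/-! ## (B.2) in the source's setting -/

/-- **(B.2), uniform version.** For every `c′` there is `C` such that for all `D ≥ 3`, all real `v` with
`|v| ≤ 3α(1 + 5|c′|α𝓛)` and all `X ≤ ⌊P²⌋`:
`Σ_{n≤X, (n,𝔮)>1} |ϱ_v(n)|/n ≤ C𝓛⁻⁸`. [cite: Zhang2022LandauSiegel, Appendix B (B.2)] -/
theorem appB2_rho (c' : ℝ) : ∃ C : ℝ, 0 ≤ C ∧ ∀ D : ℕ, 3 ≤ D → ∀ v : ℝ,
    |v| ≤ 3 * alpha D * (1 + 5 * |c'| * alpha D * ell D) → ∀ X : ℕ, X ≤ ⌊bigP D ^ 2⌋₊ →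
      ∑ n ∈ (Icc 1 X).filter (fun n => ¬ Nat.Coprime n (frakq D)), ‖rho v n‖ / n ≤
        C / ell D ^ 8 := by
  set M₀ : ℝ := 1 + 5 * |c'| * Real.pi with hM₀
  have hM₀0 : 0 ≤ M₀ := by positivity
  refine ⟨36 * Real.pi * M₀ * (majorantConst 0 1 * Real.exp (12 * Real.pi * M₀)), by
    have := majorantConst_pos 0 1; positivity, fun D hD v hv X hX => ?_⟩
  obtain ⟨hℓ, hα, hαℓ, hα0⟩ := params_of_three_le hD
  have hℓ0 : 0 < ell D := by linarith
  have hmc := majorantConst_pos 0 1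
  -- `|v| ≤ 3αM₀`
  have hM : 1 + 5 * |c'| * alpha D * ell D ≤ M₀ := by
    rw [hM₀]; nlinarith [abs_nonneg c']
  have hv' : |v| ≤ 3 * alpha D * M₀ := hv.trans (by gcongr)
  rcases lt_or_ge X 2 with hX2 | hX2
  · -- `X ≤ 1`: no `n ≤ X` has a common factor with `𝔮`
    have hempty : (Icc 1 X).filter (fun n => ¬ Nat.Coprime n (frakq D)) = ∅ := by
      refine filter_eq_empty_iff.mpr fun n hn => ?_
      simp only [mem_Icc] at hn
      have : n = 1 := by omega
      subst this
      simp
    rw [hempty, sum_empty]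
    positivity
  -- `X ≥ 2`
  have hXr : (X : ℝ) ≤ bigP D ^ 2 := by
    calc (X : ℝ) ≤ ⌊bigP D ^ 2⌋₊ := by exact_mod_cast hX
      _ ≤ bigP D ^ 2 := Nat.floor_le (by positivity)
  have hX0 : (0 : ℝ) < X := by exact_mod_cast (show 0 < X by omega)
  have hlog4X : Real.log (4 * X) ≤ 4 * ell D ^ 9 := by
    have hP : Real.log (bigP D ^ 2) = 2 * ell D ^ 9 := by
      unfold bigP; rw [← Real.exp_nat_mul, Real.log_exp]; ring
    have h4 : Real.log 4 ≤ 2 := by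
      have h2 : Real.log 4 = 2 * Real.log 2 := by
        rw [show (4 : ℝ) = 2 ^ 2 by norm_num, Real.log_pow]; norm_num
      rw [h2]; linarith [Real.log_two_lt_d9]
    have hℓ9 : 1 ≤ ell D ^ 9 := one_le_pow₀ hℓ
    calc Real.log (4 * X) = Real.log 4 + Real.log X := Real.log_mul (by norm_num) hX0.ne'
      _ ≤ 2 + Real.log (bigP D ^ 2) := by
          gcongr
      _ = 2 + 2 * ell D ^ 9 := by rw [hP]
      _ ≤ 4 * ell D ^ 9 := by linarith
  have hexp : Real.exp (|v| * Real.log (4 * X)) ≤ Real.exp (12 * Real.pi * M₀) := by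
    refine Real.exp_le_exp.mpr ?_
    calc |v| * Real.log (4 * X) ≤ 3 * alpha D * M₀ * (4 * ell D ^ 9) := by
          refine mul_le_mul hv' hlog4X ?_ (by positivity)
          exact Real.log_nonneg (by linarith [show (2 : ℝ) ≤ X by exact_mod_cast hX2])
      _ = 12 * Real.pi * M₀ := by
          rw [hα]; field_simp; ring
  have hS : ∀ q ∈ (Finset.range (D ^ 4)).filter Nat.Prime, q.Prime := fun q hq => (mem_filter.mp hq).2
  have hmain := sum_norm_rho_div_not_coprime_le v hS hX2
  rw [← frakq_eq_prod] at hmain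
  have hsumq := sum_log_div_prime_window_le hD
  have hvq : |v| * ∑ q ∈ (Finset.range (D ^ 4)).filter Nat.Prime, Real.log q / q ≤
      18 * Real.pi * M₀ / ell D ^ 8 := by
    calc |v| * ∑ q ∈ (Finset.range (D ^ 4)).filter Nat.Prime, Real.log q / q
        ≤ 3 * alpha D * M₀ * (6 * ell D) :=
          mul_le_mul hv' hsumq (sum_nonneg fun q hq => div_nonneg
            (Real.log_nonneg (by exact_mod_cast (hS q hq).one_lt.le)) (Nat.cast_nonneg _))
            (by positivity)
      _ = 18 * Real.pi * M₀ / ell D ^ 8 := by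
          rw [hα]; field_simp; ring
  calc ∑ n ∈ (Icc 1 X).filter (fun n => ¬ Nat.Coprime n (frakq D)), ‖rho v n‖ / n
      ≤ 2 * (majorantConst 0 1 * Real.exp (|v| * Real.log (4 * X))) *
          (|v| * ∑ q ∈ (Finset.range (D ^ 4)).filter Nat.Prime, Real.log q / q) := hmain
    _ ≤ 2 * (majorantConst 0 1 * Real.exp (12 * Real.pi * M₀)) * (18 * Real.pi * M₀ / ell D ^ 8) := by
        gcongr
    _ = 36 * Real.pi * M₀ * (majorantConst 0 1 * Real.exp (12 * Real.pi * M₀)) / ell D ^ 8 := by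
        ring

/-- **(B.2)** (Appendix B, p. 107 of the source): "`Σ_{n<P, (n,𝔮)>1} |ϱ_j(n)|/n ≪ 𝓛⁻⁸`", PROVED
unconditionally, for every `j` (`β_j ∈ {β₁,β₂,β₃}`) and every range `n ≤ X ≤ ⌊P²⌋` (any reading of
"`n < P`" is a sub-range), with `ϱ_j(n) = Σ_{d∣n} μ(d)d^{β_j}` spelled out. DAG node `Z22:(B.2)`.
[cite: Zhang2022LandauSiegel, Appendix B (B.2)] -/
theorem appB2_bound (c' : ℝ) : ∃ C : ℝ, ForAllLarge fun D _ _ => ∀ j X : ℕ, X ≤ ⌊bigP D ^ 2⌋₊ →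
    ∑ n ∈ (Icc 1 X).filter (fun n => ¬ Nat.Coprime n (frakq D)),
      ‖∑ d ∈ n.divisors, (ArithmeticFunction.moebius d : ℂ) * (d : ℂ) ^ betaJ c' D j‖ / n ≤
        C / ell D ^ 8 := by
  obtain ⟨C, -, hC⟩ := appB2_rho c'
  refine ⟨C, 3, fun D _ _ hD _ _ j X hX => ?_⟩
  obtain ⟨v, hv, hvle⟩ := betaJ_eq_ofReal_mul_I c' D j
  simp only [rho_eq_sum_of_betaJ hv]
  exact hC D hD v hvle X hX

end Literature.NumberTheory.LFunctions.Zhang2022.AppendixBVarrho
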